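import Literature.RingTheory.Idempotents.AutComplexCentralIdempotentOrbit
import HarnessLib

/-!
# Field automorphisms act TRANSITIVELY on the blocks below a centrally primitive rational idempotent — any field `L ≃ ℂ`
# (transport of ★ `AutComplexCentralIdempotentOrbit` along a ring isomorphism, e.g. `ι_ℓ : ℂ ≃ ℚ̄_ℓ`)

Topic `RingTheory/Idempotents`; namespace `Literature.RingTheory.Idempotents`.  THEOREMS ONLY (no definition, no named fact, no instance, no `sorry`).
★ `AutComplexCentralIdempotentOrbit.forall_exists_map_aut_apply_eq_of_isCentrallyPrimitive` is the `ℂ` edition ([Lam2001FirstCourse] §22 (22.1) + Galois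
descent [Milne2017] Cor. 4.34): for a ℚ-algebra `A`, `e ∈ A` centrally primitive and a finite orthogonal family `(c_i)` of non-zero central idempotents of
`ℂ ⊗_ℚ A` with `Σ c_i = 1 ⊗ e`, stable under all `τ ⊗ id` (`τ ∈ Aut ℂ`), the family is ONE `Aut(ℂ)`-orbit.  This file transports the statement to ANY field
`L` with a ring isomorphism `eL : ℂ ≃+* L` (the cell՚s `ι_ℓ : ℂ ≃ ℚ̄_ℓ`, [Liu2021] §4.2): conjugation by
`Φ := eL⁻¹ ⊗ id : L ⊗_ℚ A ≃ₐ[ℚ] ℂ ⊗_ℚ A` carries orthogonal central idempotent families, the sum `1 ⊗ e` and the automorphism actions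
(`τ ↦ eL ∘ τ ∘ eL⁻¹`) across.

* `congr_map_aut_apply` — `Φ ∘ (τ′ ⊗ id) = (τ ⊗ id) ∘ Φ` for `τ′ = eL ∘ τ ∘ eL⁻¹`;
* **`forall_exists_map_aut_apply_eq_of_isCentrallyPrimitive_of_ringEquiv`** — the `L`-edition of the orbit theorem.

Cell note (hodgecm-mathlib, crux `HLiu418` = stmt-HodgeConjecture-24832, d6 S2′ socket (MO)): used with `L = ℚ̄_ℓ` to move the multiplicity-one datum from the
`ω⋆`-block to every Galois-conjugate block; count-neutral; HC_CM is proved only modulo the 7 printed citations until rung 0 closes.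

## References
* [Lam2001FirstCourse] T. Y. Lam, *A First Course in Noncommutative Rings*, 2nd ed., GTM 131 (2001), §22, Prop. (22.1) (p. 326).
* [Milne2017] J. S. Milne, *Algebraic Groups*, CUP (2017), Prop. 4.31 and Cor. 4.34.
* [Liu2021] Y. Liu, Camb. J. Math. 9 (2021), §4.2 (FJcycle.tex l. 2162–2165) (`ι_ℓ`), App. D p. 133.
-/

set_option autoImplicit false

noncomputable section

open scoped TensorProduct

namespace Literature.RingTheory.Idempotents

variable {A : Type*} [Ring A] [Algebra ℚ A] {L : Type*} [Field L] [CharZero L] (eL : ℂ ≃+* L)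

/-- `eL⁻¹` as a ℚ-algebra isomorphism `L ≃ₐ[ℚ] ℂ` (ring isomorphisms of characteristic-zero fields commute with the rational scalars).
[cite: Milne2017, Prop. 4.31 and Cor. 4.34] -/
private theorem symm_algebraMap (q : ℚ) : eL.symm (algebraMap ℚ L q) = algebraMap ℚ ℂ q := by
  rw [Algebra.algebraMap_eq_smul_one, Algebra.algebraMap_eq_smul_one, map_rat_smul, map_one]

/-- **`Φ ∘ (τ′ ⊗ id) = (τ ⊗ id) ∘ Φ`** for `Φ = eL⁻¹ ⊗ id` and `τ′ = eL ∘ τ ∘ eL⁻¹`. [cite: Milne2017, Prop. 4.31 and Cor. 4.34] -/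
theorem congr_map_aut_apply (τ : ℂ ≃+* ℂ) (x : L ⊗[ℚ] A) :
    Algebra.TensorProduct.congr (AlgEquiv.ofRingEquiv (symm_algebraMap eL)) (AlgEquiv.refl : A ≃ₐ[ℚ] A)
        (Algebra.TensorProduct.map ((eL.symm.trans τ).trans eL).toRingHom.toRatAlgHom (AlgHom.id ℚ A) x) =
      Algebra.TensorProduct.map τ.toRingHom.toRatAlgHom (AlgHom.id ℚ A)
        (Algebra.TensorProduct.congr (AlgEquiv.ofRingEquiv (symm_algebraMap eL)) (AlgEquiv.refl : A ≃ₐ[ℚ] A) x) := by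
  induction x using TensorProduct.induction_on with
  | zero => rw [map_zero, map_zero, map_zero]
  | tmul z a =>
    rw [Algebra.TensorProduct.map_tmul, Algebra.TensorProduct.congr_apply, Algebra.TensorProduct.congr_apply,
      Algebra.TensorProduct.map_tmul, Algebra.TensorProduct.map_tmul, Algebra.TensorProduct.map_tmul]
    change eL.symm (((eL.symm.trans τ).trans eL) z) ⊗ₜ[ℚ] a = τ (eL.symm z) ⊗ₜ[ℚ] a
    congr 1
    simp
  | add x y hx hy => rw [map_add, map_add, map_add, map_add, hx, hy]

include eL in
/-- **FIELD AUTOMORPHISMS ARE TRANSITIVE ON THE BLOCKS BELOW A CENTRALLY PRIMITIVE RATIONAL IDEMPOTENT, for any field `L ≃ ℂ`** (★ the `ℂ` edition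
transported along `eL : ℂ ≃+* L`): `e ∈ A` centrally primitive, `(c_i)_{i ∈ I}` pairwise orthogonal non-zero central idempotents of `L ⊗_ℚ A` with
`Σ_i c_i = 1 ⊗ e`, stable under every `τ ⊗ id` (`τ : L ≃+* L`) ⇒ for all `i, j` some `τ` carries `c_i` to `c_j`.
[cite: Lam2001FirstCourse, §22 Prop. (22.1) (1)–(2), p. 326] [cite: Milne2017, Prop. 4.31 and Cor. 4.34] [cite: Liu2021, §4.2 (FJcycle.tex l. 2162–2165)] -/
theorem forall_exists_map_aut_apply_eq_of_isCentrallyPrimitive_of_ringEquiv {I : Type*} [Fintype I] [DecidableEq I] {c : I → L ⊗[ℚ] A}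
    (hc : OrthogonalIdempotents c) (hcz : ∀ i (x : L ⊗[ℚ] A), c i * x = x * c i) (hne : ∀ i, c i ≠ 0) {e : A} (he : IsCentrallyPrimitive e)
    (hsum : ∑ i, c i = (1 : L) ⊗ₜ[ℚ] e)
    (hstab : ∀ (τ : L ≃+* L) (i : I), ∃ j, Algebra.TensorProduct.map τ.toRingHom.toRatAlgHom (AlgHom.id ℚ A) (c i) = c j)
    (i j : I) : ∃ τ : L ≃+* L, Algebra.TensorProduct.map τ.toRingHom.toRatAlgHom (AlgHom.id ℚ A) (c i) = c j := by
  classical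
  set Φ : L ⊗[ℚ] A ≃ₐ[ℚ] ℂ ⊗[ℚ] A :=
    Algebra.TensorProduct.congr (AlgEquiv.ofRingEquiv (symm_algebraMap eL)) (AlgEquiv.refl : A ≃ₐ[ℚ] A) with hΦ
  -- the transported family
  have hc' : OrthogonalIdempotents (fun i => Φ (c i)) := hc.map Φ.toRingHom
  have hcz' : ∀ i (x : ℂ ⊗[ℚ] A), Φ (c i) * x = x * Φ (c i) := by
    intro i x
    obtain ⟨y, rfl⟩ := Φ.surjective x
    rw [← map_mul, ← map_mul, hcz]
  have hne' : ∀ i, Φ (c i) ≠ 0 := fun i h => hne i (by rwa [map_eq_zero_iff Φ Φ.injective] at h)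
  have hsum' : ∑ i, Φ (c i) = (1 : ℂ) ⊗ₜ[ℚ] e := by
    rw [← map_sum, hsum, hΦ, Algebra.TensorProduct.congr_apply, Algebra.TensorProduct.map_tmul]
    change eL.symm 1 ⊗ₜ[ℚ] e = (1 : ℂ) ⊗ₜ[ℚ] e
    rw [map_one]
  have hstab' : ∀ (τ : ℂ ≃+* ℂ) (i : I), ∃ j, Algebra.TensorProduct.map τ.toRingHom.toRatAlgHom (AlgHom.id ℚ A) (Φ (c i)) = Φ (c j) := by
    intro τ i
    obtain ⟨j, hj⟩ := hstab ((eL.symm.trans τ).trans eL) i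
    refine ⟨j, ?_⟩
    rw [hΦ, ← congr_map_aut_apply eL τ (c i), hj]
  obtain ⟨τ₀, hτ₀⟩ := forall_exists_map_aut_apply_eq_of_isCentrallyPrimitive hc' hcz' hne' he hsum' hstab' i j
  refine ⟨(eL.symm.trans τ₀).trans eL, Φ.injective ?_⟩
  rw [hΦ, congr_map_aut_apply eL τ₀ (c i)]
  exact hτ₀

end Literature.RingTheory.Idempotents
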